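/-
Copyright (c) 2026 the pub-hodgecm-mathlib formalisation cell (harness21).  Prover seat hodgecm-mathlib-F0P3a-p01 (g37), FLOOR 0, SUPPORTS-ONLY on h413; β-BOARD v1 R10
(assembler ∕ chair): THE FOOT LINES — tower 1's whole foot line `n₁ = n₂ + s` is `0` (R7-B ★ p861363 ⊔ R7-C ★ p861953), hence tower 3's (`hF₃`) by ★ p862014's transport.  2026-09-04.
-/
import Summits.HodgeConjecture.HodgeConjecture.Theorems.F0P3cDyRamLabelledOddGlueWindow              -- ★ p861953 (LH7-p05 (g0)): R7-C `…_of_foot_window`; brings ★ p861363's B rows? (no: imported next)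
import Summits.HodgeConjecture.HodgeConjecture.Theorems.F0P3cDyRamLabelledOddGlueClasses             -- ★ p861363 (LH7-p05 (g0)): R7-B `…_of_foot_tube`, `…_of_foot_top`
import Summits.HodgeConjecture.HodgeConjecture.Theorems.F0P3cDyRamLabelledOddTowerThreeOfTowerOne    -- ★ p862014 (LH7-p07 (g0)): tower 3 = tower 1 by (0 2) ∘ α⁻¹, `…_eq_zero_of_foot_of_G1`
import Summits.HodgeConjecture.HodgeConjecture.Theorems.F0P3cDyRamLabelledOddStageBTable             -- ★ p861403 (this seat): record lemmas (`three_mul_sub_two_add_mod_le_n0DerivedOfRecord`); brings `two_le_d_of_v_two_lt_one`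
import HarnessLib

/-!
# Crux `H413`, LH4 «(D-RAM) FOUR-FRAME» road, STAGE 1b (β) — THE FOOT LINES OF TOWERS 1 AND 3 ARE ZERO (rows R7-B ⊔ R7-C of tower 1; `hF₃` of the rest assembly)

Cell `hodgecm-mathlib` (D-0151), FLOOR 0, crux item H413 = `stmt-HodgeConjecture-24833`, route `HCCMUnconditional`; squad F0∕P3c∕LH4.  THEOREMS ONLY (no `def`, no instance, no
notation, no `sorry`, default heartbeats); ★-only imports; lane `--supports stmt-HodgeConjecture-24833 --as helper` (count-neutral; pays NO row).

WHAT THIS FILE DOES (chair's LEDGER #15–#17; LH7-p07 (g0)'s 16:35:24Z junction ask).  On the glue foot `n₁ = n₂ + s` of tower 1 every glued stratum `G₁ = (2ρ, 2ρ+s, 2ρ+s)`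
(`ρ, s ≥ 1`) carries clean-shell labelled-odd value `0`: by the parity of the datum (`n₂ ≡ ℓ₀ (mod 2)`, ★ `depth_mod_two_eq_of_isElementDatum`) the foot is the disjoint union
of the TUBE RANGE `2ρ + ℓ₀ + 2 ≤ n₂` (★ p861363 `…_of_foot_tube`, LH7-p05 R7-B), the TOP `2n₂ < 2ρ + mcOfRecord d` (★ p861363 `…_of_foot_top`) and the WINDOW `n₂ ≤ 2ρ + ℓ₀`,
`2ρ + mcOfRecord d ≤ 2n₂` (★ p861953 `…_of_foot_window`, LH7-p05 R7-C) — §1, stated as the ∀-datum FOOT SCHEMA at the derived threshold that ★ p862014 (LH7-p07 (g0), tower 3 =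
tower 1 by the coordinate swap (0 2) composed with the unit homothety `α⁻¹`) consumes; §2 is then the tower-3 foot line `hF₃` of ★ p861938 `restSum_eq_restTarget_of_rows`
VERBATIM: on `n₃ = n₂ + s` every `G₃ = (2ρ+s, 2ρ+s, 2ρ)` carries `0`.  (The tower-2 foot needs no line: its window is ★ `…RestRowsG2OfSwap.window_G2_of_G1` and its tube∕top rows
are ★ p861791, both already inside the assembly.)
HONEST LABEL.  Count-neutral junction; `hRest`, (β) OPEN; `HC_CM` is proved only modulo the 7 printed citations (2 remaining named inputs: hLiu418 = `stmt-HodgeConjecture-24832`,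
h413 = `stmt-HodgeConjecture-24833`) until rung 0 closes.

## References
* [Kottwitz1986BaseChangeUnits] R. E. Kottwitz, *Base change for unit elements of Hecke algebras*, Compositio Math. 60 (1986), §1 pp. 240–241 (lattice counts by strata).
* [Rogawski1990] J. D. Rogawski, *Automorphic Representations of Unitary Groups in Three Variables*, Ann. of Math. Stud. 123 (1990), §4.9 Prop. 4.9.1 (a)(b) p. 55.
-/

set_option autoImplicit false

noncomputable section

namespace Summit.HodgeConjecture.HodgeConjecture.Cruxes.H413.F0P3cDyRamOddLabelledFootLines

open Literature.NumberTheory.Automorphic Literature.NumberTheory.Automorphic.HermitianLattice Literature.NumberTheory.Automorphic.UnitaryGroup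
open Literature.NumberTheory.Automorphic.UnitaryLatticeTree Literature.NumberTheory.Automorphic.UnitaryThreeFourFrame
open Summit.HodgeConjecture.HodgeConjecture.Cruxes.H413.F0P3cDyRamFourFramePieces
open Summit.HodgeConjecture.HodgeConjecture.Cruxes.H413.F0P3cDyRamFourFrameCensusDefs
open Summit.HodgeConjecture.HodgeConjecture.Cruxes.H413.F0P3cDyRamStageOneBDefs (mcOfRecord)
open Summit.HodgeConjecture.HodgeConjecture.Cruxes.H413.F0P3cDyRamStageOneBDerivedDefs (n0DerivedOfRecord mcOfRecord_le_n0DerivedOfRecord)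
open Summit.HodgeConjecture.HodgeConjecture.Cruxes.H413.F0P3cDyRamDiagonalTorusDefs
open Summit.HodgeConjecture.HodgeConjecture.Cruxes.H413.F0P3cDyRamDiagonalStrataDefs
open Summit.HodgeConjecture.HodgeConjecture.Cruxes.H413.F0P3cDyRamLabelledOddCountDefs
open Summit.HodgeConjecture.HodgeConjecture.Cruxes.H413.F0P3cDyRamLabelledOddGlueClasses
open Summit.HodgeConjecture.HodgeConjecture.Cruxes.H413.F0P3cDyRamLabelledOddGlueWindow (finsum_stratum_G1_shell_labelledOdd_div_relIndex_eq_zero_of_foot_window)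
open Summit.HodgeConjecture.HodgeConjecture.Cruxes.H413.F0P3cDyRamLabelledOddTowerThreeOfTowerOne (finsum_stratum_G3_shell_labelledOdd_div_relIndex_eq_zero_of_foot_of_G1)
open Summit.HodgeConjecture.HodgeConjecture.Cruxes.H413.F0P3cDyRamLabelledOddStageBTable (three_mul_sub_two_add_mod_le_n0DerivedOfRecord)
open Summit.HodgeConjecture.HodgeConjecture.Cruxes.H413.F0P3cDyRamElementDatumParity (depth_mod_two_eq_of_isElementDatum)
open Summit.HodgeConjecture.HodgeConjecture.Cruxes.H413.F0P3cDyRamDiagonalKappaCoreHangingClass (two_le_d_of_v_two_lt_one)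
open scoped Valued WithZero Matrix MatrixGroups

variable {K : Type} [Field K] [Valued K ℤᵐ⁰] [CompleteSpace K] [Fintype 𝓀[K]] {σ : K →+* K} {ϖ : K} {d t : ℕ}

/-! ## §1  The tower-1 foot schema at the derived threshold -/

/-- **THE FOOT LINE OF TOWER 1 IS ZERO** — the ∀-datum foot schema at `N₀ = n0DerivedOfRecord d` (the `hF₁` binder of ★ p862014 VERBATIM): at every element datum and every
`T' = diag(α', β', 1)`, on the foot `n₁' = n₂' + s` (`ρ, s ≥ 1`) the clean-shell labelled-odd table of `G₁ = (2ρ, 2ρ+s, 2ρ+s)` is `0` in every slot — tube range ⊔ top ⊔ window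
by the parity `n₂' ≡ ℓ₀ (mod 2)` (★ p861363 `…_of_foot_tube` ∕ `…_of_foot_top`, ★ p861953 `…_of_foot_window`). [cite: Kottwitz1986BaseChangeUnits, §1 pp. 240–241]
[cite: Rogawski1990, §4.9 Prop. 4.9.1 (a)(b) p. 55] -/
theorem footLine_G1 (h2 : Valued.v (2 : K) < 1) (hD : IsRamifiedQuadraticDatum σ ϖ d t) :
    ∀ {α' β' : K} {n₁' n₂' n₃' : ℕ} (T' : GL (Fin 3) K), IsElementDatum σ ϖ (n0DerivedOfRecord d) α' β' n₁' n₂' n₃' →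
      (T' : Matrix (Fin 3) (Fin 3) K) = Matrix.diagonal ![α', β', 1] →
        ∀ (ρ s : ℕ), 1 ≤ ρ → 1 ≤ s → 2 ∣ s → n₁' = n₂' + s → ∀ i : Fin 3,
          ∑ᶠ M ∈ {M : Submodule 𝒪[K] (Fin 3 → K) | M ∈ stratum σ ϖ T' ![2 * ρ, 2 * ρ + s, 2 * ρ + s] ∧
              (LatticeInLevel ϖ (d % 2) (Matrix.diagonal ![α' - 1, β' - 1, 0]) M ∧ ¬ LatticeInLevel ϖ (d % 2 + 1) (Matrix.diagonal ![α' - 1, β' - 1, 0]) M ∧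
                LatticeInLevel ϖ (mcOfRecord d) (Matrix.diagonal ![(α' - 1) * (α' - 1), (β' - 1) * (β' - 1), 0]) M)},
            (labelledOddCount σ ϖ 0 i (valueClassLabel σ ϖ (α' - 1) (β' - 1) (mstarOfRecord d) d) M : ℚ) /
              ((((unitStabilizer M).map (unitNormMap σ 3)).relIndex (fixedUnitTorus σ 3) : ℕ) : ℚ) = 0 := by
  intro α' β' n₁' n₂' n₃' T' hE' hT' ρ s hρ hs _ hfoot i
  -- the derived record's letters
  have h2d : 2 ≤ d := two_le_d_of_v_two_lt_one hD h2
  have hmc : mcOfRecord d ≤ n0DerivedOfRecord d := mcOfRecord_le_n0DerivedOfRecord d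
  have hreg := three_mul_sub_two_add_mod_le_n0DerivedOfRecord d
  have hdN₀ : d ≤ n0DerivedOfRecord d := le_trans (by omega) hreg
  obtain ⟨-, hp2, -⟩ := depth_mod_two_eq_of_isElementDatum hD hE' hdN₀
  by_cases htube : 2 * ρ + d % 2 + 2 ≤ n₂'
  · -- tube range (R7-B)
    exact finsum_stratum_G1_shell_labelledOdd_div_relIndex_eq_zero_of_foot_tube hD hE' T' ρ s hρ hs hfoot htube i
  · by_cases htop : 2 * n₂' < 2 * ρ + mcOfRecord d
    · -- above the top (R7-B)
      exact finsum_stratum_G1_shell_labelledOdd_div_relIndex_eq_zero_of_foot_top hD hE' T' ρ s hρ hs hfoot htop i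
    · -- the window (R7-C): parity closes the seam `n₂' = 2ρ + ℓ₀ + 1`
      exact finsum_stratum_G1_shell_labelledOdd_div_relIndex_eq_zero_of_foot_window hD h2 h2d hE' hdN₀ hmc T' hT' ρ s hρ hs hfoot (by omega) (by omega) i

/-! ## §2  The tower-3 foot line `hF₃` -/

/-- **THE FOOT LINE OF TOWER 3 IS ZERO** — the `hF₃` binder of ★ p861938 `restSum_eq_restTarget_of_rows` VERBATIM: at a derived-record datum, on the foot `n₃ = n₂ + s`
(`ρ, s ≥ 1`, `2 ∣ s`) the clean-shell labelled-odd table of `G₃ = (2ρ+s, 2ρ+s, 2ρ)` is `0` in every slot — §1 through ★ p862014 (LH7-p07 (g0)): tower 3 is tower 1 at the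
element datum `(α⁻¹, β∕α; n₃, n₂, n₁)` by the coordinate swap (0 2) and the unit homothety `α⁻¹`. [cite: Kottwitz1986BaseChangeUnits, §1 pp. 240–241]
[cite: Rogawski1990, §4.9 Prop. 4.9.1 (a)(b) p. 55] -/
theorem footLine_G3 (h2 : Valued.v (2 : K) < 1) (hD : IsRamifiedQuadraticDatum σ ϖ d t) {α β : K} {n₁ n₂ n₃ : ℕ}
    (hE : IsElementDatum σ ϖ (n0DerivedOfRecord d) α β n₁ n₂ n₃)
    (T : GL (Fin 3) K) (hT : (T : Matrix (Fin 3) (Fin 3) K) = Matrix.diagonal ![α, β, 1]) :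
    ∀ (ρ s : ℕ), 1 ≤ ρ → 1 ≤ s → 2 ∣ s → n₃ = n₂ + s → ∀ i : Fin 3,
      ∑ᶠ M ∈ {M : Submodule 𝒪[K] (Fin 3 → K) | M ∈ stratum σ ϖ T ![2 * ρ + s, 2 * ρ + s, 2 * ρ] ∧
          (LatticeInLevel ϖ (d % 2) (Matrix.diagonal ![α - 1, β - 1, 0]) M ∧ ¬ LatticeInLevel ϖ (d % 2 + 1) (Matrix.diagonal ![α - 1, β - 1, 0]) M ∧
            LatticeInLevel ϖ (mcOfRecord d) (Matrix.diagonal ![(α - 1) * (α - 1), (β - 1) * (β - 1), 0]) M)},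
        (labelledOddCount σ ϖ 0 i (valueClassLabel σ ϖ (α - 1) (β - 1) (mstarOfRecord d) d) M : ℚ) /
          ((((unitStabilizer M).map (unitNormMap σ 3)).relIndex (fixedUnitTorus σ 3) : ℕ) : ℚ) = 0 :=
  finsum_stratum_G3_shell_labelledOdd_div_relIndex_eq_zero_of_foot_of_G1 hD hE hT (footLine_G1 h2 hD)

end Summit.HodgeConjecture.HodgeConjecture.Cruxes.H413.F0P3cDyRamOddLabelledFootLines

end
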